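import Mathlib.Analysis.Complex.RemovableSingularity
import Mathlib.Analysis.Complex.CauchyIntegral
import Mathlib.Analysis.Complex.Convex
import Mathlib.Analysis.Meromorphic.Basic
import Mathlib.Analysis.Analytic.IsolatedZeros
import Mathlib.Analysis.Calculus.Deriv.Star
import Mathlib.Analysis.SpecialFunctions.Complex.Arg
import Mathlib.Analysis.SpecialFunctions.Complex.Log
import Mathlib.Analysis.SpecialFunctions.Pow.Real
import HarnessLib

/-!
# Pick engine helper (line `pick-half-plane`, stub `stub_pickEngine`): no essential singularity

Support file for crux `BoundaryClosureR` (stmt-CriticalPhenomena-14004), line `pick-half-plane`,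
stub `stub_pickEngine`, STAGE 2 at a pinned flat root `x`.  After the two-arm reflection
(`…PickEngineTwoArm`) the straightened developing map `G = e^{-iθ} (h - p) (z - x)^{1/4}` is
holomorphic on the punctured disc `B(x, r) ∖ {x}` and REAL on the east ray; the root wedge of
`HalfPlaneBounds` (ii) says that `φ = (z - x)^{-1/4} G` takes values in a closed half-plane
`{w | -M ≤ re (ω̄ w)}` on the closed upper half-disc.  If the wedge direction `ω` is tied to the
arms — `re ω > 0` and `re ω > im ω`, i.e. `arg ω ∈ (-π/2, π/4)` in coordinates where the east
arm is the positive real axis (the natural bisector `ω = e^{-iπ/8}` qualifies) — then `G` OMITS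
the disc `B(-R, 1)` for `R` large (upper half: the principal power `(z - x)^{-1/4}` lies in the
cone `{-π/4 ≤ arg ≤ 0}`, on which `re (ω̄ u) ≥ c₀ |u|`; lower half: real symmetry of `G`, from
its realness on the east ray by the identity theorem), hence `G` is MEROMORPHIC at `x` by the
Casorati–Weierstrass theorem (contrapositive: `1/(G + R)` is bounded, so its singularity is
removable).  With `…PickEngineRootOrder` this gives the exact order `5/4` at the root.

* `isPreconnected_ball_diff_center` — a punctured disc is preconnected (four convex half-discs);
* `meromorphicAt_of_le_norm_sub` — Casorati–Weierstrass, contrapositive form;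
* `conj_apply_reflect` — real on the east ray ⇒ `G (x + conj (z - x)) = conj (G z)`;
* `pickEngine_noEssentialSingularity` — the statement above (registered sub-goal).

References: Ahlfors, *Complex Analysis* (1979), Ch. 4 §3.2 (Casorati–Weierstrass); Conway
(1978) IX.1.1 (reflection).  Mathlib: `Complex.differentiableOn_update_limUnder_of_bddAbove`,
`AnalyticOnNhd.eqOn_of_preconnected_of_frequently_eq`, `MeromorphicAt`.
-/

noncomputable section

open scoped Topology ComplexConjugate
open Filter Set Metric Complex Function

namespace Summit.CriticalPhenomena.SAWScalingLimit.Theorems.PickHalfPlane.Engine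

/-- A punctured open disc in `ℂ` is preconnected: it is the union of the four open half-discs
`{im ≷ im x} ∩ B`, `{re ≷ re x} ∩ B`, each convex, consecutive ones meeting. [folklore] -/
theorem isPreconnected_ball_diff_center (x : ℂ) {r : ℝ} (hr : 0 < r) :
    IsPreconnected (ball x r \ {x}) := by
  set H₁ : Set ℂ := ball x r ∩ {z : ℂ | x.im < z.im} with hH₁
  set H₂ : Set ℂ := ball x r ∩ {z : ℂ | x.re < z.re} with hH₂
  set H₃ : Set ℂ := ball x r ∩ {z : ℂ | z.im < x.im} with hH₃
  set H₄ : Set ℂ := ball x r ∩ {z : ℂ | z.re < x.re} with hH₄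
  have hc₁ : IsPreconnected H₁ :=
    ((convex_ball x r).inter (convex_halfSpace_im_gt _)).isPreconnected
  have hc₂ : IsPreconnected H₂ :=
    ((convex_ball x r).inter (convex_halfSpace_re_gt _)).isPreconnected
  have hc₃ : IsPreconnected H₃ :=
    ((convex_ball x r).inter (convex_halfSpace_im_lt _)).isPreconnected
  have hc₄ : IsPreconnected H₄ :=
    ((convex_ball x r).inter (convex_halfSpace_re_lt _)).isPreconnected
  set d : ℝ := r / 4 with hd
  have hd0 : 0 < d := by rw [hd]; linarith
  have hball : ∀ s t : ℝ, |s| = d → |t| = d → x + ((s : ℂ) + (t : ℂ) * I) ∈ ball x r := by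
    intro s t hs ht
    rw [mem_ball, dist_eq_norm, add_sub_cancel_left]
    calc ‖(s : ℂ) + (t : ℂ) * I‖ ≤ ‖(s : ℂ)‖ + ‖(t : ℂ) * I‖ := norm_add_le _ _
      _ = d + d := by
        rw [norm_mul, Complex.norm_I, mul_one, Complex.norm_real, Complex.norm_real,
          Real.norm_eq_abs, Real.norm_eq_abs, hs, ht]
      _ < r := by rw [hd]; linarith
  have hp₁₂ : x + ((d : ℂ) + (d : ℂ) * I) ∈ H₁ ∩ H₂ :=
    ⟨⟨hball d d (abs_of_pos hd0) (abs_of_pos hd0), by show x.im < _; simp [hd0]⟩,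
      ⟨hball d d (abs_of_pos hd0) (abs_of_pos hd0), by show x.re < _; simp [hd0]⟩⟩
  have hp₂₃ : x + ((d : ℂ) + ((-d : ℝ) : ℂ) * I) ∈ H₂ ∩ H₃ :=
    ⟨⟨hball d (-d) (abs_of_pos hd0) (by rw [abs_neg, abs_of_pos hd0]), by show x.re < _; simp [hd0]⟩,
      ⟨hball d (-d) (abs_of_pos hd0) (by rw [abs_neg, abs_of_pos hd0]), by show _ < x.im; simp [hd0]⟩⟩
  have hp₃₄ : x + (((-d : ℝ) : ℂ) + ((-d : ℝ) : ℂ) * I) ∈ H₃ ∩ H₄ :=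
    ⟨⟨hball (-d) (-d) (by rw [abs_neg, abs_of_pos hd0]) (by rw [abs_neg, abs_of_pos hd0]),
        by show _ < x.im; simp [hd0]⟩,
      ⟨hball (-d) (-d) (by rw [abs_neg, abs_of_pos hd0]) (by rw [abs_neg, abs_of_pos hd0]),
        by show _ < x.re; simp [hd0]⟩⟩
  have h12 : IsPreconnected (H₁ ∪ H₂) := hc₁.union _ hp₁₂.1 hp₁₂.2 hc₂
  have h123 : IsPreconnected (H₁ ∪ H₂ ∪ H₃) := h12.union _ (Or.inr hp₂₃.1) hp₂₃.2 hc₃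
  have h1234 : IsPreconnected (H₁ ∪ H₂ ∪ H₃ ∪ H₄) := h123.union _ (Or.inr hp₃₄.1) hp₃₄.2 hc₄
  have heq : ball x r \ {x} = H₁ ∪ H₂ ∪ H₃ ∪ H₄ := by
    ext z
    simp only [Set.mem_sdiff, mem_singleton_iff, mem_union, hH₁, hH₂, hH₃, hH₄, mem_inter_iff,
      mem_setOf_eq]
    constructor
    · rintro ⟨hz, hzx⟩
      by_contra hcon
      push Not at hcon
      apply hzx
      apply Complex.ext
      · have h2 := hcon.1.1.2 hz; have h4 := hcon.2 hz; linarith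
      · have h1 := hcon.1.1.1 hz; have h3 := hcon.1.2 hz; linarith
    · rintro (((⟨hz, h⟩ | ⟨hz, h⟩) | ⟨hz, h⟩) | ⟨hz, h⟩) <;> refine ⟨hz, ?_⟩ <;> rintro rfl <;>
        exact lt_irrefl _ h
  rw [heq]
  exact h1234

/-- **Casorati–Weierstrass, contrapositive.** If `G` is holomorphic on the punctured disc
`B(x, r) ∖ {x}` and omits the disc `B(w₀, ε)` there, then `G` is meromorphic at `x`: the function
`k = (G - w₀)⁻¹` is holomorphic and bounded by `ε⁻¹`, so its singularity at `x` is removable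
(`Complex.differentiableOn_update_limUnder_of_bddAbove`), and `G = w₀ + k⁻¹` is meromorphic.
(Ahlfors 1979, Ch. 4 §3.2.) [folklore] -/
theorem meromorphicAt_of_le_norm_sub {x w₀ : ℂ} {r ε : ℝ} {G : ℂ → ℂ} (hr : 0 < r) (hε : 0 < ε)
    (hG : DifferentiableOn ℂ G (ball x r \ {x}))
    (homit : ∀ z ∈ ball x r \ {x}, ε ≤ ‖G z - w₀‖) : MeromorphicAt G x := by
  set k : ℂ → ℂ := fun z => (G z - w₀)⁻¹ with hk
  have hne : ∀ z ∈ ball x r \ {x}, G z - w₀ ≠ 0 := fun z hz h0 => by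
    have := homit z hz; rw [h0, norm_zero] at this; linarith
  have hkd : DifferentiableOn ℂ k (ball x r \ {x}) := (hG.sub_const w₀).inv hne
  have hkb : BddAbove (norm ∘ k '' (ball x r \ {x})) := by
    refine ⟨ε⁻¹, ?_⟩
    rintro _ ⟨z, hz, rfl⟩
    simp only [comp_apply, hk, norm_inv]
    exact inv_anti₀ hε (homit z hz)
  set k' : ℂ → ℂ := update k x (limUnder (𝓝[≠] x) k) with hk'
  have hk'd : DifferentiableOn ℂ k' (ball x r) :=
    differentiableOn_update_limUnder_of_bddAbove (ball_mem_nhds x hr) hkd hkb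
  have hk'm : MeromorphicAt k' x :=
    (hk'd.analyticAt (ball_mem_nhds x hr)).meromorphicAt
  have hkk' : k' =ᶠ[𝓝[≠] x] k := by
    filter_upwards [self_mem_nhdsWithin] with z hz
    exact update_of_ne hz _ _
  have hkm : MeromorphicAt k x := hk'm.congr hkk'
  have hGm : MeromorphicAt (fun z => (k z)⁻¹ + w₀) x := hkm.inv.add (MeromorphicAt.const w₀ x)
  refine hGm.congr ?_
  filter_upwards with z
  simp [hk]

/-- **Real on the east ray ⇒ real-symmetric.** A function holomorphic on the punctured disc
`B(x, r) ∖ {x}` which is real on the east ray `{im z = im x, re z > re x}` satisfies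
`G (x + conj (z - x)) = conj (G z)` on the punctured disc (identity theorem: both sides are
holomorphic in `z` and agree on the ray). [folklore] -/
theorem conj_apply_reflect {x : ℂ} {r : ℝ} {G : ℂ → ℂ} (hr : 0 < r)
    (hG : DifferentiableOn ℂ G (ball x r \ {x}))
    (hreal : ∀ z ∈ ball x r, z.im = x.im → x.re < z.re → (G z).im = 0) :
    ∀ z ∈ ball x r \ {x}, G (x + conj (z - x)) = conj (G z) := by
  set P : Set ℂ := ball x r \ {x} with hP
  have hPopen : IsOpen P := isOpen_ball.sdiff isClosed_singleton
  set ρ : ℂ → ℂ := fun z => x + conj (z - x) with hρ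
  have hρsub : ∀ z, ρ z - x = conj (z - x) := fun z => by simp [hρ]
  have hρP : ∀ z ∈ P, ρ z ∈ P := by
    rintro z ⟨hz, hzx⟩
    refine ⟨?_, ?_⟩
    · rw [mem_ball, dist_eq_norm] at hz ⊢
      rw [hρsub, Complex.norm_conj]
      exact hz
    · intro h
      apply hzx
      have h2 : conj (z - x) = 0 := by rw [← hρsub, show ρ z = x from h, sub_self]
      have h3 := congrArg conj h2
      simpa [sub_eq_zero] using h3
  -- `G₁ = conj ∘ G ∘ ρ` is holomorphic on `P`
  set G₁ : ℂ → ℂ := fun z => conj (G (ρ z)) with hG₁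
  have hG₁d : DifferentiableOn ℂ G₁ P := by
    intro z hz
    have hGat : DifferentiableAt ℂ G (ρ z) := hG.differentiableAt (hPopen.mem_nhds (hρP z hz))
    -- `G ∘ (x + ·)` is differentiable at `conj (z - x)`; conjugate inside and outside
    have h1 : DifferentiableAt ℂ (fun w => G (x + w)) (conj (z - x)) := by
      have : ρ z = x + conj (z - x) := rfl
      rw [this] at hGat
      exact hGat.comp _ ((differentiableAt_const x).add differentiableAt_id)
    have h2 := h1.conj_conj
    rw [Complex.conj_conj] at h2
    -- `h2 : DifferentiableAt ℂ (conj ∘ (fun w => G (x + w)) ∘ conj) (z - x)`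
    have h3 := h2.comp z (differentiableAt_id.sub_const x)
    have heq : ((conj ∘ (fun w => G (x + w)) ∘ conj) ∘ fun y => id y - x) = G₁ := by
      funext w; simp [hG₁, hρ]
    rw [heq] at h3
    exact h3.differentiableWithinAt
  have hGa : AnalyticOnNhd ℂ G P := hG.analyticOnNhd hPopen
  have hG₁a : AnalyticOnNhd ℂ G₁ P := hG₁d.analyticOnNhd hPopen
  -- they agree on the east ray, which accumulates at `z₀ = x + r/2`
  set z₀ : ℂ := x + ((r / 2 : ℝ) : ℂ) with hz₀
  have hz₀P : z₀ ∈ P := by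
    refine ⟨?_, ?_⟩
    · rw [mem_ball, dist_eq_norm, hz₀, add_sub_cancel_left, Complex.norm_real, Real.norm_eq_abs,
        abs_of_pos (by linarith)]
      linarith
    · intro h
      have : ((r / 2 : ℝ) : ℂ) = 0 := by simpa [hz₀] using h
      have : (r / 2 : ℝ) = 0 := by exact_mod_cast this
      linarith
  have hfreq : ∃ᶠ z in 𝓝[≠] z₀, G₁ z = G z := by
    -- along the real direction: `z₀ + t`, `t → 0`, `t ≠ 0`
    have htend : Tendsto (fun t : ℝ => z₀ + (t : ℂ)) (𝓝[≠] 0) (𝓝[≠] z₀) := by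
      refine tendsto_nhdsWithin_iff.2 ⟨?_, ?_⟩
      · have : Tendsto (fun t : ℝ => z₀ + (t : ℂ)) (𝓝 0) (𝓝 (z₀ + ((0 : ℝ) : ℂ))) :=
          (Complex.continuous_ofReal.tendsto 0).const_add z₀
        simpa using this.mono_left nhdsWithin_le_nhds
      · filter_upwards [self_mem_nhdsWithin] with t ht
        simpa using ht
    have hev : ∀ᶠ t : ℝ in 𝓝[≠] 0, G₁ (z₀ + (t : ℂ)) = G (z₀ + (t : ℂ)) := by
      have hsmall : ∀ᶠ t : ℝ in 𝓝[≠] (0 : ℝ), |t| < r / 2 := by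
        have : Ioo (-(r / 2)) (r / 2) ∈ 𝓝 (0 : ℝ) := Ioo_mem_nhds (by linarith) (by linarith)
        filter_upwards [mem_nhdsWithin_of_mem_nhds this] with t ht
        exact abs_lt.2 ht
      filter_upwards [hsmall] with t ht
      have htr : -(r / 2) < t ∧ t < r / 2 := abs_lt.1 ht
      have hmem : z₀ + (t : ℂ) ∈ ball x r := by
        rw [mem_ball, dist_eq_norm, hz₀, show x + ((r / 2 : ℝ) : ℂ) + (t : ℂ) - x =
          ((r / 2 + t : ℝ) : ℂ) by push_cast; ring, Complex.norm_real, Real.norm_eq_abs]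
        rw [abs_lt]; constructor <;> linarith
      have him : (z₀ + (t : ℂ)).im = x.im := by simp [hz₀]
      have hre : x.re < (z₀ + (t : ℂ)).re := by simp [hz₀]; linarith
      have hreal' := hreal _ hmem him hre
      have hρfix : ρ (z₀ + (t : ℂ)) = z₀ + (t : ℂ) := by
        have h1 : z₀ + (t : ℂ) - x = ((r / 2 + t : ℝ) : ℂ) := by rw [hz₀]; push_cast; ring
        simp only [hρ]
        rw [h1, Complex.conj_ofReal, hz₀]
        push_cast; ring
      simp only [hG₁, hρfix]
      exact Complex.conj_eq_iff_im.2 hreal'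
    exact htend.frequently hev.frequently
  have hEq : EqOn G₁ G P :=
    hG₁a.eqOn_of_preconnected_of_frequently_eq hGa (isPreconnected_ball_diff_center x hr) hz₀P hfreq
  intro z hz
  have h := congrArg conj (hEq hz)
  simpa [hG₁, hρ] using h

/-- The cone estimate: for `u` in the closed cone `{im u ≤ 0 ≤ re u + im u}` (directions
`[-π/4, 0]`) one has `re (ω̄ u) ≥ (min (re ω) (re ω - im ω) / 2) · |u|`. [folklore] -/
theorem re_conj_mul_ge_of_mem_cone {ω u : ℂ} (hω : 0 ≤ min ω.re (ω.re - ω.im))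
    (hu₁ : u.im ≤ 0) (hu₂ : 0 ≤ u.re + u.im) :
    min ω.re (ω.re - ω.im) / 2 * ‖u‖ ≤ ((starRingEnd ℂ) ω * u).re := by
  set m := min ω.re (ω.re - ω.im) with hm
  have hre : ((starRingEnd ℂ) ω * u).re = ω.re * (u.re + u.im) + (ω.re - ω.im) * (-u.im) := by
    simp [Complex.mul_re]; ring
  have h1 : m * (u.re + u.im) ≤ ω.re * (u.re + u.im) :=
    mul_le_mul_of_nonneg_right (min_le_left _ _) hu₂
  have h2 : m * (-u.im) ≤ (ω.re - ω.im) * (-u.im) :=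
    mul_le_mul_of_nonneg_right (min_le_right _ _) (by linarith)
  have hnorm : ‖u‖ ≤ |u.re| + |u.im| := Complex.norm_le_abs_re_add_abs_im u
  have hre0 : 0 ≤ u.re := by linarith
  rw [abs_of_nonneg hre0, abs_of_nonpos hu₁] at hnorm
  have h3 : ‖u‖ ≤ 2 * u.re := by linarith
  calc m / 2 * ‖u‖ ≤ m / 2 * (2 * u.re) := mul_le_mul_of_nonneg_left h3 (by linarith)
    _ = m * (u.re + u.im) + m * (-u.im) := by ring
    _ ≤ _ := by rw [hre]; exact add_le_add h1 h2

/-- The principal power `v ^ (-1/4)` of a nonzero `v` in the closed upper half-plane lies in the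
cone `{im ≤ 0 ≤ re + im}` (its argument is `-arg v / 4 ∈ [-π/4, 0]`), and has modulus
`|v| ^ (-1/4)`. [folklore] -/
theorem cpow_neg_quarter_mem_cone {v : ℂ} (hv : v ≠ 0) (hvim : 0 ≤ v.im) :
    (v ^ (-(1 / 4 : ℂ))).im ≤ 0 ∧ 0 ≤ (v ^ (-(1 / 4 : ℂ))).re + (v ^ (-(1 / 4 : ℂ))).im ∧
      ‖v ^ (-(1 / 4 : ℂ))‖ = ‖v‖ ^ (-(1 / 4 : ℝ)) := by
  set a : ℝ := arg v / 4 with ha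
  have ha0 : 0 ≤ a := by rw [ha]; linarith [arg_nonneg_iff.2 hvim]
  have haπ : a ≤ Real.pi / 4 := by rw [ha]; linarith [arg_le_pi v]
  set E : ℝ := Real.exp (-(1 / 4) * Real.log ‖v‖) with hE
  have hexp : v ^ (-(1 / 4 : ℂ)) = (E : ℂ) * (Real.cos a - Real.sin a * I) := by
    rw [cpow_def_of_ne_zero hv, show log v * (-(1 / 4 : ℂ)) =
        ((-(1 / 4) * Real.log ‖v‖ : ℝ) : ℂ) + ((-a : ℝ) : ℂ) * I by
      apply Complex.ext <;> simp [Complex.log_re, Complex.log_im, ha] <;> ring,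
      Complex.exp_add, Complex.exp_mul_I, ← Complex.ofReal_exp, ← hE]
    push_cast
    rw [Complex.cos_neg, Complex.sin_neg]
    ring
  have hre : (v ^ (-(1 / 4 : ℂ))).re = E * Real.cos a := by
    rw [hexp]; simp [Complex.cos_ofReal_re, Complex.sin_ofReal_re]
  have him : (v ^ (-(1 / 4 : ℂ))).im = -(E * Real.sin a) := by
    rw [hexp]; simp [Complex.cos_ofReal_im, Complex.sin_ofReal_im, Complex.cos_ofReal_re,
      Complex.sin_ofReal_re]
  have hE0 : 0 < E := Real.exp_pos _
  have hsin : 0 ≤ Real.sin a := Real.sin_nonneg_of_nonneg_of_le_pi ha0 (by linarith [Real.pi_pos])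
  have hsc : Real.sin a ≤ Real.cos a := by
    calc Real.sin a ≤ Real.sin (Real.pi / 4) :=
          Real.sin_le_sin_of_le_of_le_pi_div_two (by linarith [Real.pi_pos])
            (by linarith [Real.pi_pos]) haπ
      _ = Real.cos (Real.pi / 4) := by rw [Real.sin_pi_div_four, Real.cos_pi_div_four]
      _ ≤ Real.cos a := Real.cos_le_cos_of_nonneg_of_le_pi ha0 (by linarith [Real.pi_pos]) haπ
  refine ⟨?_, ?_, ?_⟩
  · rw [him]; nlinarith
  · rw [hre, him]; nlinarith
  · rw [show (-(1 / 4 : ℂ)) = ((-(1 / 4) : ℝ) : ℂ) by push_cast; ring, norm_cpow_real]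

/-- **No essential singularity at the root (registered sub-goal `pickEngine_noEssentialSingularity`
of stub `stub_pickEngine`).** Let `G` be holomorphic on the punctured disc `B(x, r) ∖ {x}`, real on
the east ray, and suppose `φ = (z - x)^{-1/4} G` (principal branch) satisfies `-M ≤ re (ω̄ φ)` on
the closed upper half-disc punctured at `x`, for a direction `ω` with `re ω > 0` and
`re ω > im ω` (i.e. `arg ω ∈ (-π/2, π/4)` relative to the east arm; the bisector `e^{-iπ/8}` of
the root wedge qualifies). Then `G` is meromorphic at `x`: it omits the disc `B(-R, 1)` for
`R c₀ = |ω| + (|M| + 1) r^{1/4}`, `c₀ = min (re ω) (re ω - im ω) / 2` (cone estimate above, real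
symmetry below the diameter), and Casorati–Weierstrass applies. [folklore] -/
theorem pickEngine_noEssentialSingularity :
    ∀ (x ω : ℂ) (r M : ℝ) (G : ℂ → ℂ), 0 < r → 0 < ω.re → ω.im < ω.re →
      DifferentiableOn ℂ G (Metric.ball x r \ {x}) →
      (∀ z ∈ Metric.ball x r, z.im = x.im → x.re < z.re → (G z).im = 0) →
      (∀ z ∈ ({z : ℂ | x.im ≤ z.im} ∩ Metric.ball x r) \ {x},
        -M ≤ ((starRingEnd ℂ) ω * ((z - x) ^ (-(1 / 4 : ℂ)) * G z)).re) →
      MeromorphicAt G x := by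
  intro x ω r M G hr hω₁ hω₂ hG hreal hhalf
  set m : ℝ := min ω.re (ω.re - ω.im) with hm
  have hm0 : 0 < m := lt_min hω₁ (by linarith)
  set c₀ : ℝ := m / 2 with hc₀
  have hc₀0 : 0 < c₀ := by rw [hc₀]; linarith
  set R : ℝ := (‖ω‖ + (|M| + 1) * r ^ (1 / 4 : ℝ)) / c₀ with hR
  have hRc : R * c₀ - ‖ω‖ = (|M| + 1) * r ^ (1 / 4 : ℝ) := by
    rw [hR, div_mul_cancel₀ _ hc₀0.ne']; ring
  have hr14 : 0 < r ^ (1 / 4 : ℝ) := Real.rpow_pos_of_pos hr _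
  have hR0 : 0 ≤ R := by rw [hR]; positivity
  -- the omitted disc, on the closed upper punctured half-disc
  have hup : ∀ z ∈ ({z : ℂ | x.im ≤ z.im} ∩ ball x r) \ {x}, 1 ≤ ‖G z - (-(R : ℂ))‖ := by
    rintro z ⟨⟨hzim, hz⟩, hzx⟩
    have hzim' : x.im ≤ z.im := hzim
    by_contra hlt
    have hlt : ‖G z + R‖ < 1 := by simpa [sub_neg_eq_add] using lt_of_not_ge hlt
    set v : ℂ := z - x with hv
    have hv0 : v ≠ 0 := sub_ne_zero.2 hzx
    have hvim : 0 ≤ v.im := by simp only [hv, sub_im, sub_nonneg]; exact hzim'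
    obtain ⟨hu₁, hu₂, hun⟩ := cpow_neg_quarter_mem_cone hv0 hvim
    set u : ℂ := v ^ (-(1 / 4 : ℂ)) with hu
    -- size of `u`
    have hvn : ‖v‖ < r := by rwa [mem_ball, dist_eq_norm] at hz
    have hun' : r ^ (-(1 / 4 : ℝ)) ≤ ‖u‖ := by
      rw [hun]
      exact Real.rpow_le_rpow_of_nonpos (norm_pos_iff.2 hv0) hvn.le (by norm_num)
    have hprod : r ^ (-(1 / 4 : ℝ)) * r ^ (1 / 4 : ℝ) = 1 := by
      rw [← Real.rpow_add hr]; norm_num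
    have hu_big : |M| + 1 ≤ ‖u‖ * ((|M| + 1) * r ^ (1 / 4 : ℝ)) := by
      calc |M| + 1 = r ^ (-(1 / 4 : ℝ)) * r ^ (1 / 4 : ℝ) * (|M| + 1) := by rw [hprod, one_mul]
        _ = r ^ (-(1 / 4 : ℝ)) * ((|M| + 1) * r ^ (1 / 4 : ℝ)) := by ring
        _ ≤ ‖u‖ * ((|M| + 1) * r ^ (1 / 4 : ℝ)) :=
          mul_le_mul_of_nonneg_right hun' (by positivity)
    -- the cone estimate and the splitting `u·G = u·(-R) + u·(G + R)`
    have hcone : c₀ * ‖u‖ ≤ ((starRingEnd ℂ) ω * u).re := by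
      rw [hc₀, hm]; exact re_conj_mul_ge_of_mem_cone hm0.le hu₁ hu₂
    have hsplit : ((starRingEnd ℂ) ω * (u * G z)).re =
        -R * ((starRingEnd ℂ) ω * u).re + ((starRingEnd ℂ) ω * u * (G z + R)).re := by
      have : (starRingEnd ℂ) ω * (u * G z) =
          ((-R : ℝ) : ℂ) * ((starRingEnd ℂ) ω * u) + (starRingEnd ℂ) ω * u * (G z + R) := by
        push_cast; ring
      rw [this, Complex.add_re, Complex.re_ofReal_mul]
    have hsmall : ((starRingEnd ℂ) ω * u * (G z + R)).re ≤ ‖ω‖ * ‖u‖ := by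
      refine (Complex.re_le_norm _).trans ?_
      rw [norm_mul, norm_mul, Complex.norm_conj]
      calc ‖ω‖ * ‖u‖ * ‖G z + R‖ ≤ ‖ω‖ * ‖u‖ * 1 :=
            mul_le_mul_of_nonneg_left hlt.le (by positivity)
        _ = ‖ω‖ * ‖u‖ := mul_one _
    have hbound : ((starRingEnd ℂ) ω * (u * G z)).re ≤ -(|M| + 1) := by
      rw [hsplit]
      have h1 : -R * ((starRingEnd ℂ) ω * u).re ≤ -R * (c₀ * ‖u‖) := by
        have := mul_le_mul_of_nonneg_left hcone hR0
        linarith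
      calc -R * ((starRingEnd ℂ) ω * u).re + ((starRingEnd ℂ) ω * u * (G z + R)).re
          ≤ -R * (c₀ * ‖u‖) + ‖ω‖ * ‖u‖ := add_le_add h1 hsmall
        _ = -(‖u‖ * (R * c₀ - ‖ω‖)) := by ring
        _ = -(‖u‖ * ((|M| + 1) * r ^ (1 / 4 : ℝ))) := by rw [hRc]
        _ ≤ -(|M| + 1) := by linarith [hu_big]
    have hge := hhalf z ⟨⟨hzim, hz⟩, hzx⟩
    have habs := le_abs_self M
    linarith
  -- the whole punctured disc, by real symmetry below the diameter
  refine meromorphicAt_of_le_norm_sub hr one_pos hG (w₀ := -(R : ℂ)) ?_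
  rintro z ⟨hz, hzx⟩
  rcases le_or_gt x.im z.im with hzim | hzim
  · exact hup z ⟨⟨hzim, hz⟩, hzx⟩
  · set z' : ℂ := x + conj (z - x) with hz'
    have hz'sub : z' - x = conj (z - x) := by rw [hz']; ring
    have hz'im : x.im ≤ z'.im := by
      have : z'.im = x.im + (x.im - z.im) := by simp [hz']; ring
      rw [this]; linarith
    have hz'b : z' ∈ ball x r := by
      rw [mem_ball, dist_eq_norm] at hz ⊢
      rw [hz'sub, Complex.norm_conj]; exact hz
    have hz'x : z' ≠ x := by
      intro h
      apply hzx
      have h2 : conj (z - x) = 0 := by rw [← hz'sub, h, sub_self]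
      have h3 := congrArg conj h2
      simpa [sub_eq_zero] using h3
    have hsym := conj_apply_reflect hr hG hreal z' ⟨hz'b, hz'x⟩
    have hzz : x + conj (z' - x) = z := by rw [hz'sub, Complex.conj_conj]; ring
    rw [hzz] at hsym
    have h1 := hup z' ⟨⟨hz'im, hz'b⟩, hz'x⟩
    calc (1 : ℝ) ≤ ‖G z' - (-(R : ℂ))‖ := h1
      _ = ‖G z - (-(R : ℂ))‖ := by
        rw [hsym, sub_neg_eq_add, sub_neg_eq_add, ← Complex.norm_conj (G z' + R), map_add,
          Complex.conj_ofReal]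

end Summit.CriticalPhenomena.SAWScalingLimit.Theorems.PickHalfPlane.Engine

end
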